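import Mathlib.Analysis.Calculus.SmoothSeries
import Mathlib.Analysis.Calculus.MeanValue
import Mathlib.Analysis.SpecialFunctions.Log.Deriv
import Mathlib.Analysis.SpecialFunctions.Pow.Real
import Mathlib.MeasureTheory.Measure.OpenPos
import Mathlib.Analysis.SpecificLimits.Basic
import Literature.Analysis.Fourier.FourierCompactSupportAnalytic
import Literature.Analysis.FunctionSpaces.PlancherelL1L2
import HarnessLib

/-!
# BD18 Lemma 2.11: the quantitative Beurling–Malliavin lemma, from the multiplier theorem

Topic `Literature/Analysis/Fourier`. J. Bourgain, S. Dyatlov, *Spectral gaps without the pressure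
condition*, Ann. of Math. 187 (2018), §2.3. Theorem 5 there is the Beurling–Malliavin multiplier
theorem (Beurling–Malliavin 1962; Mashreghi–Nazarov–Havin 2006): for `ω ∈ C¹(ℝ; (0,1])` with
`∫ |log ω|/(1+ξ²) < ∞` and `sup |∂ log ω| < ∞` and every `c₀ > 0` there is `ψ ∈ L²`, `ψ ≢ 0`,
`supp ψ ⊂ [-c₀, c₀]`, `|ψ̂| ≤ ω`. Lemma 2.11 is its quantitative refinement: for all `C₀, c₀ > 0`
there is `c = c(C₀, c₀) > 0` such that every such `ω` with `∫ |log ω|/(1+ξ²) ≤ C₀`,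
`sup |∂ log ω| ≤ C₀` admits `ψ` with `supp ψ ⊂ [-c₀, c₀]`, `|ψ̂| ≤ ω^c` and `‖ψ̂‖_{L²(-1,1)} ≥ c`.

This file PROVES Lemma 2.11 from Theorem 5, the latter entering as an explicit hypothesis `hBM`
(no named fact is introduced), following the printed compactness argument: if the lemma failed for
`c = 2^{-n-1}`, `n = 0, 1, …`, with witnesses `ω_n`, the product weight `ω = ∏ ω_n^{2^{-n-1}}`
would satisfy the hypotheses of Theorem 5 (`prodWeight_spec`: it is `C¹` by termwise
differentiation of `∑ 2^{-n-1} log ω_n`, its log-derivative is bounded by `∑ 2^{-n-1} C₀ = C₀`, and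
`∫ |log ω|/(1+ξ²) ≤ C₀` by monotone convergence — using the a priori bound
`|log ω_n(ξ)| ≤ 3C₀ + C₀|ξ|`, `abs_log_weight_le`), and the `ψ` it provides would have
`‖ψ̂‖_{L²(-1,1)} < 2^{-n-1}` for every `n`, so `ψ̂ = 0` on `(-1, 1)`; as `ψ` has compact support,
`ψ̂` is entire and `ψ = 0` a.e. (`ae_eq_zero_of_fourier_eqOn_Ioo`), a contradiction.

* `bd18_lemma_2_11_of_multiplierTheorem` — the statement (with `‖ψ̂‖²_{L²(-1,1)} ≥ c`, an
  equivalent normalisation of the printed `‖ψ̂‖_{L²(-1,1)} ≥ c`).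
-/

namespace Literature.Analysis.Fourier

open _root_.MeasureTheory Set Filter
open scoped FourierTransform Real Topology ENNReal

/-- **A priori bound on an admissible weight** (implicit in BD18 §2.3): if `log ω` is
differentiable with `|∂ log ω| ≤ C₀` and `∫ |log ω(ξ)|/(1+ξ²) dξ ≤ C₀`, then
`|log ω(ξ)| ≤ 3C₀ + C₀|ξ|`. [cite: BourgainDyatlov2018, Lemma 2.11 (proof)] -/
theorem abs_log_weight_le {ω : ℝ → ℝ} {C₀ : ℝ}
    (hdiff : Differentiable ℝ (fun η => Real.log (ω η)))
    (hderiv : ∀ ξ, |deriv (fun η => Real.log (ω η)) ξ| ≤ C₀)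
    (hint : Integrable (fun ξ => |Real.log (ω ξ)| / (1 + ξ ^ 2)))
    (hI : ∫ ξ, |Real.log (ω ξ)| / (1 + ξ ^ 2) ≤ C₀) (ξ : ℝ) :
    |Real.log (ω ξ)| ≤ 3 * C₀ + C₀ * |ξ| := by
  have hC₀ : 0 ≤ C₀ := (abs_nonneg _).trans (hderiv 0)
  -- Lipschitz bound
  have hlip : ∀ x y : ℝ, |Real.log (ω y) - Real.log (ω x)| ≤ C₀ * |y - x| := by
    intro x y
    have := Convex.norm_image_sub_le_of_norm_deriv_le (f := fun η => Real.log (ω η))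
      (fun z _ => hdiff z) (fun z _ => by simpa using hderiv z) convex_univ (mem_univ x) (mem_univ y)
    simpa [Real.norm_eq_abs] using this
  set L : ℝ → ℝ := fun η => |Real.log (ω η)| with hL
  have hL0 : L 0 ≤ 3 * C₀ := by
    by_contra hcon
    push Not at hcon
    have hlow : ∀ η ∈ Icc (0 : ℝ) 1, (L 0 - C₀) / 2 ≤ L η / (1 + η ^ 2) := by
      intro η hη
      have h1 : L 0 - C₀ ≤ L η := by
        have := hlip 0 η
        simp only [sub_zero] at this
        have hη1 : |η| ≤ 1 := abs_le.2 ⟨by linarith [hη.1], hη.2⟩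
        have : |Real.log (ω η) - Real.log (ω 0)| ≤ C₀ := by nlinarith
        simp only [hL]
        have := abs_sub_abs_le_abs_sub (Real.log (ω 0)) (Real.log (ω η))
        rw [abs_sub_comm] at this
        linarith
      have h2 : 1 + η ^ 2 ≤ 2 := by nlinarith [hη.1, hη.2]
      have h3 : 0 ≤ L 0 - C₀ := by linarith
      rw [div_le_div_iff₀ (by norm_num) (by positivity)]
      nlinarith
    have hIcc : ∫ η in Icc (0 : ℝ) 1, (L 0 - C₀) / 2 ≤ ∫ η in Icc (0 : ℝ) 1, L η / (1 + η ^ 2) :=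
      setIntegral_mono_on (integrableOn_const (by simp)) hint.integrableOn measurableSet_Icc hlow
    have hconst : ∫ η in Icc (0 : ℝ) 1, (L 0 - C₀) / 2 = (L 0 - C₀) / 2 := by
      rw [setIntegral_const, Real.volume_real_Icc_of_le zero_le_one]; simp
    have hle_all : ∫ η in Icc (0 : ℝ) 1, L η / (1 + η ^ 2) ≤ ∫ η, L η / (1 + η ^ 2) :=
      setIntegral_le_integral hint (Eventually.of_forall fun η => by positivity)
    have : (L 0 - C₀) / 2 ≤ C₀ := by linarith
    linarith
  have := hlip 0 ξ
  simp only [sub_zero] at this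
  have h2 := abs_sub_abs_le_abs_sub (Real.log (ω ξ)) (Real.log (ω 0))
  simp only [hL] at hL0
  nlinarith [abs_nonneg ξ]

/-- `∑_{n ≥ 0} 2^{-n-1} = 1`. [folklore] -/
theorem tsum_half_pow_succ : ∑' n : ℕ, (1 / 2 : ℝ) ^ (n + 1) = 1 := by
  have h : ∑' n : ℕ, (1 / 2 : ℝ) ^ (n + 1) = (1 / 2) * ∑' n : ℕ, (1 / 2 : ℝ) ^ n := by
    rw [← tsum_mul_left]
    congr 1
    funext n
    ring
  rw [h, tsum_geometric_two]
  norm_num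

/-- Summability of `2^{-n-1}`. [folklore] -/
theorem summable_half_pow_succ : Summable fun n : ℕ => (1 / 2 : ℝ) ^ (n + 1) := by
  have : Summable fun n : ℕ => (1 / 2 : ℝ) * (1 / 2) ^ n :=
    (summable_geometric_two).mul_left (1 / 2)
  refine this.congr fun n => ?_
  ring

/-- **The product weight** of the proof of BD18 Lemma 2.11: given weights `ω_n ∈ C¹(ℝ;(0,1])` with
`∫ |log ω_n|/(1+ξ²) ≤ C₀` and `|∂ log ω_n| ≤ C₀`, the weight `ω = ∏_n ω_n^{2^{-n-1}}` (i.e.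
`log ω = ∑ 2^{-n-1} log ω_n`) is again `C¹`, takes values in `(0,1]`, has `∫ |log ω|/(1+ξ²) < ∞`,
`|∂ log ω| ≤ C₀`, and `ω ≤ ω_n^{2^{-n-1}}` for every `n`. [cite: BourgainDyatlov2018, Lemma 2.11 (proof)] -/
theorem exists_prodWeight {ωs : ℕ → ℝ → ℝ} {C₀ : ℝ}
    (hcd : ∀ n, ContDiff ℝ 1 (ωs n)) (hpos : ∀ n ξ, 0 < ωs n ξ) (hle : ∀ n ξ, ωs n ξ ≤ 1)
    (hint : ∀ n, Integrable (fun ξ => |Real.log (ωs n ξ)| / (1 + ξ ^ 2)))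
    (hI : ∀ n, ∫ ξ, |Real.log (ωs n ξ)| / (1 + ξ ^ 2) ≤ C₀)
    (hderiv : ∀ n ξ, |deriv (fun η => Real.log (ωs n η)) ξ| ≤ C₀) :
    ∃ ω : ℝ → ℝ, ContDiff ℝ 1 ω ∧ (∀ ξ, 0 < ω ξ) ∧ (∀ ξ, ω ξ ≤ 1) ∧
      Integrable (fun ξ => |Real.log (ω ξ)| / (1 + ξ ^ 2)) ∧
      (∀ ξ, |deriv (fun η => Real.log (ω η)) ξ| ≤ C₀) ∧
      ∀ n ξ, ω ξ ≤ ωs n ξ ^ ((1 / 2 : ℝ) ^ (n + 1)) := by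
  have hC₀ : 0 ≤ C₀ := (abs_nonneg _).trans (hderiv 0 0)
  set c : ℕ → ℝ := fun n => (1 / 2 : ℝ) ^ (n + 1) with hcdef
  have hcpos : ∀ n, 0 < c n := fun n => by positivity
  have hcsum : Summable c := summable_half_pow_succ
  have hctsum : ∑' n, c n = 1 := tsum_half_pow_succ
  -- the logarithms `ℓ n = log ∘ ω_n` and their derivatives
  set ℓ : ℕ → ℝ → ℝ := fun n η => Real.log (ωs n η) with hℓdef
  have hℓcd : ∀ n, ContDiff ℝ 1 (ℓ n) := fun n => (hcd n).log fun x => (hpos n x).ne'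
  have hℓdiff : ∀ n, Differentiable ℝ (ℓ n) := fun n => (hℓcd n).differentiable one_ne_zero
  have hℓcont' : ∀ n, Continuous (deriv (ℓ n)) := fun n => (hℓcd n).continuous_deriv le_rfl
  have hℓnonpos : ∀ n η, ℓ n η ≤ 0 := fun n η => Real.log_nonpos (hpos n η).le (hle n η)
  have hℓbound : ∀ n η, |ℓ n η| ≤ 3 * C₀ + C₀ * |η| := fun n η =>
    abs_log_weight_le (hℓdiff n) (hderiv n) (hint n) (hI n) η
  -- the series `S = ∑ c_n ℓ_n` and its termwise derivative
  set g : ℕ → ℝ → ℝ := fun n η => c n * ℓ n η with hgdef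
  set g' : ℕ → ℝ → ℝ := fun n η => c n * deriv (ℓ n) η with hg'def
  have hg_deriv : ∀ n η, HasDerivAt (g n) (g' n η) η := fun n η =>
    ((hℓdiff n η).hasDerivAt).const_mul (c n)
  have hg'_bound : ∀ n η, ‖g' n η‖ ≤ c n * C₀ := by
    intro n η
    rw [Real.norm_eq_abs, hg'def]
    simp only [abs_mul, abs_of_pos (hcpos n)]
    exact mul_le_mul_of_nonneg_left (hderiv n η) (hcpos n).le
  have hu : Summable fun n => c n * C₀ := hcsum.mul_right C₀
  have hg_summable : ∀ η, Summable fun n => g n η := by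
    intro η
    refine Summable.of_norm_bounded (g := fun n => c n * (3 * C₀ + C₀ * |η|))
      (hcsum.mul_right _) fun n => ?_
    rw [Real.norm_eq_abs, hgdef]
    simp only [abs_mul, abs_of_pos (hcpos n)]
    exact mul_le_mul_of_nonneg_left (hℓbound n η) (hcpos n).le
  set S : ℝ → ℝ := fun η => ∑' n, g n η with hSdef
  have hS_deriv : ∀ η, HasDerivAt S (∑' n, g' n η) η := fun η =>
    hasDerivAt_tsum_of_isPreconnected hu isOpen_univ isPreconnected_univ
      (fun n y _ => hg_deriv n y) (fun n y _ => hg'_bound n y) (mem_univ 0) (hg_summable 0)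
      (mem_univ η)
  have hS'_cont : Continuous fun η => ∑' n, g' n η :=
    continuous_tsum (fun n => (hℓcont' n).const_mul (c n)) hu hg'_bound
  have hS_C1 : ContDiff ℝ 1 S := by
    rw [contDiff_one_iff_deriv]
    refine ⟨fun η => (hS_deriv η).differentiableAt, ?_⟩
    have : deriv S = fun η => ∑' n, g' n η := funext fun η => (hS_deriv η).deriv
    rw [this]
    exact hS'_cont
  have hS_nonpos : ∀ η, S η ≤ 0 := fun η =>
    tsum_nonpos fun n => mul_nonpos_iff.2 (Or.inl ⟨(hcpos n).le, hℓnonpos n η⟩)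
  have hS_le_term : ∀ n η, S η ≤ g n η := by
    intro n η
    have h1 : ∀ m, g m η ≤ if m = n then g n η else 0 := by
      intro m
      by_cases hm : m = n
      · subst hm; simp
      · simp only [hm, if_false]
        exact mul_nonpos_iff.2 (Or.inl ⟨(hcpos m).le, hℓnonpos m η⟩)
    calc S η = ∑' m, g m η := rfl
      _ ≤ ∑' m, (if m = n then g n η else 0) :=
          (hg_summable η).tsum_le_tsum h1 (summable_of_ne_finset_zero (s := {n}) (by
            intro m hm
            simp only [Finset.mem_singleton] at hm
            simp [hm]))
      _ = g n η := tsum_ite_eq n (fun _ => g n η)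
  -- the weight
  refine ⟨fun η => Real.exp (S η), Real.contDiff_exp.comp hS_C1, fun η => Real.exp_pos _,
    fun η => Real.exp_le_one_iff.2 (hS_nonpos η), ?_, ?_, ?_⟩
  · -- integrability of `|log ω|/(1+ξ²) = |S|/(1+ξ²)`
    simp only [Real.log_exp]
    have hmeas : AEStronglyMeasurable (fun ξ => |S ξ| / (1 + ξ ^ 2)) volume := by
      have hSc : Continuous S := hS_C1.continuous
      exact ((continuous_abs.comp hSc).div (by fun_prop) fun ξ => by positivity).aestronglyMeasurable
    refine ⟨hmeas, ?_⟩
    -- finite integral by monotone convergence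
    have hterm_nn : ∀ n ξ, 0 ≤ c n * |ℓ n ξ| / (1 + ξ ^ 2) := fun n ξ => by positivity
    have hS_abs : ∀ ξ, |S ξ| ≤ ∑' n, c n * |ℓ n ξ| := by
      intro ξ
      have h1 : ‖∑' n, g n ξ‖ ≤ ∑' n, ‖g n ξ‖ := norm_tsum_le_tsum_norm (hg_summable ξ).norm
      simp only [Real.norm_eq_abs] at h1
      refine h1.trans (le_of_eq (tsum_congr fun n => ?_))
      simp [hgdef, abs_mul, abs_of_pos (hcpos n)]
    have hsum_abs : ∀ ξ, Summable fun n => c n * |ℓ n ξ| := by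
      intro ξ
      have := (hg_summable ξ).norm
      refine this.congr fun n => ?_
      simp [hgdef, Real.norm_eq_abs, abs_of_pos (hcpos n)]
    have hbound_pt : ∀ ξ, ENNReal.ofReal (|S ξ| / (1 + ξ ^ 2)) ≤
        ∑' n, ENNReal.ofReal (c n * |ℓ n ξ| / (1 + ξ ^ 2)) := by
      intro ξ
      have hpos1 : 0 < 1 + ξ ^ 2 := by positivity
      rw [← ENNReal.ofReal_tsum_of_nonneg (hterm_nn · ξ) ((hsum_abs ξ).div_const _)]
      apply ENNReal.ofReal_le_ofReal
      rw [tsum_div_const]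
      exact div_le_div_of_nonneg_right (hS_abs ξ) hpos1.le
    unfold HasFiniteIntegral
    calc ∫⁻ ξ, ‖|S ξ| / (1 + ξ ^ 2)‖ₑ
        = ∫⁻ ξ, ENNReal.ofReal (|S ξ| / (1 + ξ ^ 2)) := by
          congr 1; funext ξ
          rw [Real.enorm_eq_ofReal (by positivity)]
      _ ≤ ∫⁻ ξ, ∑' n, ENNReal.ofReal (c n * |ℓ n ξ| / (1 + ξ ^ 2)) := lintegral_mono hbound_pt
      _ = ∑' n, ∫⁻ ξ, ENNReal.ofReal (c n * |ℓ n ξ| / (1 + ξ ^ 2)) := by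
          apply lintegral_tsum
          intro n
          exact (((hint n).const_mul (c n)).aestronglyMeasurable.aemeasurable.ennreal_ofReal).congr
            (Eventually.of_forall fun ξ => by simp [hℓdef, mul_div_assoc])
      _ = ∑' n, ENNReal.ofReal (∫ ξ, c n * |ℓ n ξ| / (1 + ξ ^ 2)) := by
          congr 1; funext n
          rw [ofReal_integral_eq_lintegral_ofReal]
          · exact ((hint n).const_mul (c n)).congr (Eventually.of_forall fun ξ => by
              simp [hℓdef, mul_div_assoc])
          · exact Eventually.of_forall fun ξ => hterm_nn n ξ
      _ ≤ ∑' n, ENNReal.ofReal (c n * C₀) := by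
          apply ENNReal.tsum_le_tsum
          intro n
          apply ENNReal.ofReal_le_ofReal
          have : ∫ ξ, c n * |ℓ n ξ| / (1 + ξ ^ 2) = c n * ∫ ξ, |ℓ n ξ| / (1 + ξ ^ 2) := by
            rw [← integral_const_mul]
            congr 1; funext ξ; ring
          rw [this]
          exact mul_le_mul_of_nonneg_left (hI n) (hcpos n).le
      _ = ENNReal.ofReal (∑' n, c n * C₀) :=
          (ENNReal.ofReal_tsum_of_nonneg (fun n => by positivity) hu).symm
      _ < ⊤ := ENNReal.ofReal_lt_top
  · -- the log-derivative
    intro ξ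
    have hlog : (fun η => Real.log (Real.exp (S η))) = S := funext fun η => Real.log_exp _
    rw [hlog, (hS_deriv ξ).deriv]
    have hsum' : Summable fun n => ‖g' n ξ‖ :=
      (Summable.of_norm_bounded hu (hg'_bound · ξ)).norm
    have h1 : ‖∑' n, g' n ξ‖ ≤ ∑' n, ‖g' n ξ‖ := norm_tsum_le_tsum_norm hsum'
    have h2 : ∑' n, ‖g' n ξ‖ ≤ ∑' n, c n * C₀ := hsum'.tsum_le_tsum (hg'_bound · ξ) hu
    rw [tsum_mul_right, hctsum, one_mul] at h2
    rw [← Real.norm_eq_abs]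
    exact h1.trans h2
  · -- domination by each factor
    intro n ξ
    calc Real.exp (S ξ) ≤ Real.exp (g n ξ) := Real.exp_le_exp.2 (hS_le_term n ξ)
      _ = ωs n ξ ^ ((1 / 2 : ℝ) ^ (n + 1)) := by
          rw [Real.rpow_def_of_pos (hpos n ξ), mul_comm]

/-- **BD18 Lemma 2.11 (quantitative Beurling–Malliavin) from the multiplier theorem.** The
hypothesis `hBM` is Bourgain–Dyatlov 2018, Theorem 5 (Beurling–Malliavin 1962;
Mashreghi–Nazarov–Havin 2006), verbatim: for `ω ∈ C¹(ℝ; (0,1])` with `∫ |log ω|/(1+ξ²) < ∞` and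
`sup |∂ log ω| < ∞` and every `c₀ > 0` there is `ψ ∈ L²(ℝ)` with `supp ψ ⊂ [-c₀, c₀]`, `|ψ̂| ≤ ω`,
`ψ ≢ 0`. Conclusion: for all `C₀, c₀ > 0` there is `c > 0` such that every such `ω` with
`∫ |log ω|/(1+ξ²) ≤ C₀` and `sup |∂ log ω| ≤ C₀` admits `ψ ∈ L²`, `supp ψ ⊂ [-c₀, c₀]`, `|ψ̂| ≤ ω^c`
and `‖ψ̂‖²_{L²(-1,1)} ≥ c`. [cite: BourgainDyatlov2018, Lemma 2.11] -/
theorem bd18_lemma_2_11_of_multiplierTheorem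
    (hBM : ∀ ω : ℝ → ℝ, ContDiff ℝ 1 ω → (∀ ξ, 0 < ω ξ) → (∀ ξ, ω ξ ≤ 1) →
      Integrable (fun ξ => |Real.log (ω ξ)| / (1 + ξ ^ 2)) →
      (∃ C : ℝ, ∀ ξ, |deriv (fun η => Real.log (ω η)) ξ| ≤ C) →
      ∀ c₀ : ℝ, 0 < c₀ → ∃ ψ : ℝ → ℂ, MemLp ψ 2 volume ∧ (∀ x, x ∉ Icc (-c₀) c₀ → ψ x = 0) ∧
        (∀ ξ, ‖𝓕 ψ ξ‖ ≤ ω ξ) ∧ ¬ (ψ =ᵐ[volume] 0))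
    (C₀ c₀ : ℝ) (hc₀ : 0 < c₀) :
    ∃ c : ℝ, 0 < c ∧ ∀ ω : ℝ → ℝ, ContDiff ℝ 1 ω → (∀ ξ, 0 < ω ξ) → (∀ ξ, ω ξ ≤ 1) →
      Integrable (fun ξ => |Real.log (ω ξ)| / (1 + ξ ^ 2)) →
      (∫ ξ, |Real.log (ω ξ)| / (1 + ξ ^ 2) ≤ C₀) →
      (∀ ξ, |deriv (fun η => Real.log (ω η)) ξ| ≤ C₀) →
      ∃ ψ : ℝ → ℂ, MemLp ψ 2 volume ∧ (∀ x, x ∉ Icc (-c₀) c₀ → ψ x = 0) ∧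
        (∀ ξ, ‖𝓕 ψ ξ‖ ≤ ω ξ ^ c) ∧ c ≤ ∫ ξ in Ioo (-1 : ℝ) 1, ‖𝓕 ψ ξ‖ ^ 2 := by
  by_contra hcon
  push Not at hcon
  -- witnesses `ω_n` for `c = 2^{-n-1}`
  have hc : ∀ n : ℕ, (0 : ℝ) < (1 / 2) ^ (n + 1) := fun n => by positivity
  choose ωs hωs using fun n : ℕ => hcon ((1 / 2 : ℝ) ^ (n + 1)) (hc n)
  have hcd : ∀ n, ContDiff ℝ 1 (ωs n) := fun n => (hωs n).1
  have hpos : ∀ n ξ, 0 < ωs n ξ := fun n => (hωs n).2.1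
  have hle : ∀ n ξ, ωs n ξ ≤ 1 := fun n => (hωs n).2.2.1
  have hint : ∀ n, Integrable (fun ξ => |Real.log (ωs n ξ)| / (1 + ξ ^ 2)) :=
    fun n => (hωs n).2.2.2.1
  have hI : ∀ n, ∫ ξ, |Real.log (ωs n ξ)| / (1 + ξ ^ 2) ≤ C₀ := fun n => (hωs n).2.2.2.2.1
  have hderiv : ∀ n ξ, |deriv (fun η => Real.log (ωs n η)) ξ| ≤ C₀ :=
    fun n => (hωs n).2.2.2.2.2.1
  have hbad : ∀ n (ψ : ℝ → ℂ), MemLp ψ 2 volume → (∀ x, x ∉ Icc (-c₀) c₀ → ψ x = 0) →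
      (∀ ξ, ‖𝓕 ψ ξ‖ ≤ ωs n ξ ^ ((1 / 2 : ℝ) ^ (n + 1))) →
      ∫ ξ in Ioo (-1 : ℝ) 1, ‖𝓕 ψ ξ‖ ^ 2 < (1 / 2 : ℝ) ^ (n + 1) :=
    fun n => (hωs n).2.2.2.2.2.2
  -- the product weight and the multiplier it carries
  obtain ⟨ω, hωcd, hωpos, hωle, hωint, hωderiv, hωdom⟩ :=
    exists_prodWeight hcd hpos hle hint hI hderiv
  obtain ⟨ψ, hψ2, hψsupp, hψle, hψne⟩ := hBM ω hωcd hωpos hωle hωint ⟨C₀, hωderiv⟩ c₀ hc₀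
  apply hψne
  -- `ψ` is integrable (bounded support)
  have hψ1 : Integrable ψ := by
    have hb : volume (Icc (-c₀) c₀) < ⊤ := measure_Icc_lt_top
    exact memLp_one_iff_integrable.1
      (hψ2.mono_exponent_of_measure_support_ne_top hψsupp hb.ne (by norm_num))
  -- `∫_{(-1,1)} |ψ̂|² < 2^{-n-1}` for every `n`, hence `= 0`
  have hsmall : ∀ n : ℕ, ∫ ξ in Ioo (-1 : ℝ) 1, ‖𝓕 ψ ξ‖ ^ 2 < (1 / 2 : ℝ) ^ (n + 1) := by
    intro n
    exact hbad n ψ hψ2 hψsupp fun ξ => (hψle ξ).trans (hωdom n ξ)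
  have hcontF : Continuous (𝓕 ψ) :=
    Literature.Analysis.FunctionSpaces.continuous_fourierIntegral hψ1
  have hnn : 0 ≤ ∫ ξ in Ioo (-1 : ℝ) 1, ‖𝓕 ψ ξ‖ ^ 2 :=
    setIntegral_nonneg measurableSet_Ioo fun ξ _ => by positivity
  have hzeroI : ∫ ξ in Ioo (-1 : ℝ) 1, ‖𝓕 ψ ξ‖ ^ 2 = 0 := by
    apply le_antisymm _ hnn
    have hlim : Tendsto (fun n : ℕ => (1 / 2 : ℝ) ^ (n + 1)) atTop (𝓝 0) := by
      have := (tendsto_pow_atTop_nhds_zero_of_lt_one (by norm_num : (0 : ℝ) ≤ 1 / 2)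
        (by norm_num : (1 / 2 : ℝ) < 1)).comp (tendsto_add_atTop_nat 1)
      exact this
    exact ge_of_tendsto' hlim fun n => (hsmall n).le
  -- so `ψ̂ = 0` on `(-1, 1)`
  have hint2 : IntegrableOn (fun ξ => ‖𝓕 ψ ξ‖ ^ 2) (Ioo (-1 : ℝ) 1) :=
    ((hcontF.norm.pow 2).integrableOn_Icc).mono_set Ioo_subset_Icc_self
  have hae : (fun ξ => ‖𝓕 ψ ξ‖ ^ 2) =ᵐ[volume.restrict (Ioo (-1 : ℝ) 1)] 0 :=
    (setIntegral_eq_zero_iff_of_nonneg_ae (Eventually.of_forall fun ξ => by positivity)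
      hint2).1 hzeroI
  have heq : EqOn (fun ξ => ‖𝓕 ψ ξ‖ ^ 2) 0 (Ioo (-1 : ℝ) 1) :=
    Measure.eqOn_open_of_ae_eq hae isOpen_Ioo (hcontF.norm.pow 2).continuousOn continuousOn_const
  have hzero : ∀ ξ ∈ Ioo (-1 : ℝ) 1, 𝓕 ψ ξ = 0 := by
    intro ξ hξ
    have := heq hξ
    simp only [Pi.zero_apply] at this
    exact norm_eq_zero.1 (pow_eq_zero_iff two_ne_zero |>.1 this)
  exact ae_eq_zero_of_fourier_eqOn_Ioo hψ1 hc₀.le hψsupp (by norm_num) hzero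

end Literature.Analysis.Fourier
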